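/-
Lead `ym-line-sgb-k1` (seat prover-ym-line-sgb-k1-g0-0), route `SteinGapBootstrap`, crux `SteinBlockTransferG`
(stmt-QuantumFields-22998), line `birth`: the clustering-rate bound from the torus-side plaquette floor; the `SU(2)` instance.
-/
import Summits.QuantumFields.YangMills.Theorems.SteinGapBootstrapSteinBlockTransferGClusterRate
import Summits.QuantumFields.YangMills.Theorems.WeakCouplingRatesAssembly

/-!
# Crux `SteinBlockTransferG`: the pair-clustering rate is `≤ β^{-A/2}` wherever the torus plaquette floor
# `PolySeparationPlaquetteFloor` holds — hence the `SU(2)` instance of the crux, unconditionally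

Companion of `SteinGapBootstrapSteinBlockTransferGClusterRate` (crux item stmt-QuantumFields-22998, route `SteinGapBootstrap`
rev 2, line `birth`).  Three steps, all kernel glue in the currency of `WeakCouplingRatesCurrency`:
* `clusterRate_le_log_div_of_uniformTorusPlaquetteCorr`: a volume-uniform floor `δ(β)` under the torus plaquette–plaquette
  correlator at time separation `T(β)` passes to every torus-limit state `μ` (weak convergence on bounded continuous cylinder
  observables, exactly as in the tree's `massGapUpperRateOf_of_uniformTorusPlaquetteCorr`); the origin `(i, j)`-plaquette cost is a
  `θ`-invariant positive-time observable, so hypothesis (iii) of the crux (sup-norm pair clustering at rate `m`) gives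
  `δ(β) ≤ 2 e^{-m T(β)} C²`, i.e. `m ≤ log(V/δ(β))/T(β)`.
* `clusterRate_of_polySeparationFloor`: with the power-law floor `κ β^{-(2+8A)}` at separation `⌈β^A⌉`
  (`PolySeparationPlaquetteFloor d ρ i j A κ`) this is `m ≤ β^{-A/2}` for `β` large (the arithmetic of the tree's
  `massGapPowerDecayOf_of_powerLawCorr`).
* `clusterRate_SU2` / `transfer_SU2`: for `SU(2)` (fundamental Wilson action, `d = 4`) the floor is PROVED in the tree
  (`polySeparationPlaquetteFloor_of_box` fed with `ColdBoxTwoPointFloorW_proof`, `BulkDominatesColdBoxW_proof`,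
  `curvatureCorrPowerFloor_proof` — the engine behind `xiPowSU2_holds`), so the `SU(2)` instance of the crux's conclusion holds
  NOW, for every `C₀`, by `transfer_of_clusterRate` — with no generator comparison.

What this shows for the line: AS FILED (free exponents `K`, `δ`), `SteinBlockTransferG` for a pair `(G, r)` is implied by the
torus plaquette floor for `r.ρ` — the BOX ∧ BULK content of routes `WeakCouplingRates` (SU(2), closed) / `ColdBoxAllGroups`
(all `G`, open) — and carries no content beyond it; the Stein generator comparison is needed only for a statement with PINNED
exponents (e.g. the BC5 rung `stub_rung_unitRate`, rates `m ≥ 1`).  HONEST FRAMING: an UPPER bound on lattice gaps (RECORD-label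
rung R2ξ′); nothing here bears on the Yang–Mills mass gap.
-/

set_option autoImplicit false

noncomputable section

open MeasureTheory Filter Topology
open Literature.MathematicalPhysics.QuantumFieldTheory
open Literature.MathematicalPhysics.QuantumLattice
open Literature.Probability.LatticeModels
open Summit.QuantumFields.YangMills.Theorems.WeakCouplingRates

namespace Summit.QuantumFields.YangMills.Theorems.SteinGapBootstrap

section General

variable {d N : ℕ} {G : Type*} [Group G] [TopologicalSpace G] [IsTopologicalGroup G] [CompactSpace G]
  [MeasurableSpace G] [BorelSpace G] (ρ : G →* Matrix (Fin N) (Fin N) ℂ)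

/-- **Floor ⇒ one-distance bound on the pair-clustering rate.**  A volume-uniform lower bound `δ(β) > 0` on the connected
plaquette two-point function of the torus states at time separation `T(β) ≥ 1` (`UniformTorusPlaquetteCorr`) passes to every
torus-limit state, where sup-norm pair clustering across the time hyperplane at rate `m > 0` (hypothesis (iii) of
`SteinBlockTransferG`) forces `m ≤ log(V/δ(β))/T(β)` (`V = 2C² + 1`, `C` a sup bound of the plaquette cost). -/
theorem clusterRate_le_log_div_of_uniformTorusPlaquetteCorr [NeZero d] (hρ : Continuous ρ) {i j : Fin d}
    (hi : i ≠ 0) (hj : j ≠ 0) {T : ℝ → ℕ} {δ : ℝ → ℝ} (hT : ∀ᶠ β in atTop, 1 ≤ T β)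
    (hδ : ∀ᶠ β in atTop, 0 < δ β) (h : UniformTorusPlaquetteCorr d ρ i j T δ) :
    ∃ V : ℝ, 0 < V ∧ ∃ β₀ : ℝ, ∀ β : ℝ, β₀ ≤ β → ∀ μ ∈ infiniteVolumeLimitPoints (d := d) ρ β, ∀ m : ℝ, 0 < m →
      (∀ (A B : LGConfig d G → ℝ), IsPosTimeObs A → IsPosTimeObs B → ∀ a b : ℝ, (∀ U, |A U| ≤ a) → (∀ U, |B U| ≤ b) →
        ∀ t : ℕ, |(∫ U, A (timeReflectLG U) * B (timeShiftLG (G := G) t U) ∂μ) -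
          (∫ U, A (timeReflectLG U) ∂μ) * (∫ U, B (timeShiftLG (G := G) t U) ∂μ)| ≤ 2 * Real.exp (-(m * t)) * a * b) →
      m ≤ Real.log (V / δ β) / T β := by
  obtain ⟨hcont, C, hC⟩ := continuous_bounded_plaqCost0 ρ hρ i j
  obtain ⟨hcyl, hS⟩ := plaqCost0_support (G := G) ρ hi hj
  have hC0 : 0 ≤ C := (abs_nonneg _).trans (hC (fun _ => 1))
  refine ⟨2 * C * C + 1, by positivity, ?_⟩
  obtain ⟨β₀, hβ₀⟩ := h
  obtain ⟨β₁, hβ₁⟩ := eventually_atTop.1 (hT.and hδ)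
  refine ⟨max β₀ β₁, fun β hβ μ hμ m hm hiii => ?_⟩
  obtain ⟨hTβ, hδβ⟩ := hβ₁ β ((le_max_right _ _).trans hβ)
  set F : LGConfig d G → ℝ := plaqCost0 ρ i j with hFdef
  have hpos : IsPosTimeObs F :=
    ⟨⟨_, hcyl, fun e he => (hS e he).1.ge⟩, hcont, C, hC⟩
  have hrefl : ∀ U : LGConfig d G, F (timeReflectLG U) = F U :=
    comp_timeReflectLG_eq hcyl hS
  obtain ⟨Lk, hmono, hprob, hlim⟩ := hμ
  haveI := hprob
  have hcylG := isCylinder_timeShift hcyl (T β)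
  have hcontG : Continuous fun U => F (timeShiftLG (G := G) (T β) U) :=
    hcont.comp (continuous_timeShiftLG (T β))
  have hbdG : ∃ C, ∀ U : LGConfig d G, |F (timeShiftLG (G := G) (T β) U)| ≤ C := ⟨C, fun U => hC _⟩
  have hbdP : ∃ C', ∀ U : LGConfig d G, |F U * F (timeShiftLG (G := G) (T β) U)| ≤ C' :=
    ⟨C * C, fun U => by
      rw [abs_mul]
      exact mul_le_mul (hC _) (hC _) (abs_nonneg _) ((abs_nonneg _).trans (hC U))⟩
  have tF := hlim F _ hcyl hcont ⟨C, hC⟩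
  have tG := hlim _ _ hcylG hcontG hbdG
  have tP := hlim _ _ (IsCylinder.mul hcyl hcylG) (hcont.mul hcontG) hbdP
  have hev := hmono.tendsto_atTop.eventually (hβ₀ β ((le_max_left _ _).trans hβ))
  have hcov : δ β ≤ (∫ U, F U * F (timeShiftLG (G := G) (T β) U) ∂μ) -
      (∫ U, F U ∂μ) * (∫ U, F (timeShiftLG (G := G) (T β) U) ∂μ) :=
    ge_of_tendsto (tP.sub (tF.mul tG)) hev
  -- hypothesis (iii) with `A = B = F`, `a = b = C`, at `t = T β`
  have hclus := hiii F F hpos hpos C C hC hC (T β)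
  simp only [hrefl] at hclus
  have h1 : δ β ≤ Real.exp (-(m * (T β))) * (2 * C * C) := by
    have := (le_abs_self _).trans hclus
    nlinarith [hcov, this]
  -- `δ ≤ e^{-mT} · 2C² ≤ e^{-mT} V` ⇒ `m ≤ log(V/δ)/T`
  have hexp : 0 < Real.exp (-(m * (T β))) := Real.exp_pos _
  have hV0 : 0 < 2 * C * C + 1 := by positivity
  have h2 : δ β ≤ Real.exp (-(m * (T β))) * (2 * C * C + 1) :=
    h1.trans (mul_le_mul_of_nonneg_left (by linarith) hexp.le)
  have ht0 : (0 : ℝ) < (T β : ℝ) := by exact_mod_cast hTβ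
  have h3 : Real.log (δ β) ≤ -(m * (T β)) + Real.log (2 * C * C + 1) := by
    have := Real.log_le_log hδβ h2
    rwa [Real.log_mul hexp.ne' hV0.ne', Real.log_exp] at this
  rw [le_div_iff₀ ht0, Real.log_div hV0.ne' hδβ.ne']
  linarith

/-- **Power-law floor ⇒ power-rate bound on the pair-clustering rate.**  If the connected plaquette correlator of the torus states
at time separation `⌈β^A⌉` is `≥ κ β^{-(2+8A)}` uniformly in the volume (`PolySeparationPlaquetteFloor d ρ i j A κ`, `A, κ > 0`,
spatial plane `i, j ≠ 0`), then for `β` large every torus-limit state that is sup-norm pair-clustering across the time hyperplane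
at rate `m > 0` has `m ≤ β^{-A/2}`. -/
theorem clusterRate_of_polySeparationFloor [NeZero d] (hρ : Continuous ρ) {i j : Fin d} (hi : i ≠ 0) (hj : j ≠ 0)
    {A κ : ℝ} (hA : 0 < A) (hκ : 0 < κ) (h : PolySeparationPlaquetteFloor d ρ i j A κ) :
    ∃ β₁ : ℝ, ∀ β : ℝ, β₁ ≤ β → ∀ μ ∈ infiniteVolumeLimitPoints (d := d) ρ β, ∀ m : ℝ, 0 < m →
      (∀ (A B : LGConfig d G → ℝ), IsPosTimeObs A → IsPosTimeObs B → ∀ a b : ℝ, (∀ U, |A U| ≤ a) → (∀ U, |B U| ≤ b) →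
        ∀ t : ℕ, |(∫ U, A (timeReflectLG U) * B (timeShiftLG (G := G) t U) ∂μ) -
          (∫ U, A (timeReflectLG U) ∂μ) * (∫ U, B (timeShiftLG (G := G) t U) ∂μ)| ≤ 2 * Real.exp (-(m * t)) * a * b) →
      m ≤ β ^ (-(A / 2)) := by
  have hT : ∀ᶠ β : ℝ in atTop, 1 ≤ ⌈β ^ A⌉₊ := by
    filter_upwards [eventually_gt_atTop 0] with β hβ
    exact Nat.one_le_iff_ne_zero.2 (Nat.pos_iff_ne_zero.1 (Nat.ceil_pos.2 (Real.rpow_pos_of_pos hβ A)))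
  have hδ : ∀ᶠ β : ℝ in atTop, 0 < κ * β ^ (-(2 + 8 * A)) := by
    filter_upwards [eventually_gt_atTop 0] with β hβ
    exact mul_pos hκ (Real.rpow_pos_of_pos hβ _)
  obtain ⟨V, hV, β₀, hrate⟩ := clusterRate_le_log_div_of_uniformTorusPlaquetteCorr ρ hρ hi hj hT hδ h
  -- eventual domination `log(V/(κ β^{-a}))/⌈β^A⌉ ≤ β^{-A/2}`, `a = 2 + 8A` (as in `massGapPowerDecayOf_of_powerLawCorr`)
  set a : ℝ := 2 + 8 * A with hadef
  have hA2 : 0 < A / 2 := by linarith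
  have hnum : Tendsto (fun β : ℝ => (Real.log (V / κ) + a * Real.log β) / β ^ (A / 2)) atTop (𝓝 0) := by
    have h1 : Tendsto (fun β : ℝ => Real.log (V / κ) / β ^ (A / 2)) atTop (𝓝 0) :=
      tendsto_const_nhds.div_atTop (tendsto_rpow_atTop hA2)
    have h2 : Tendsto (fun β : ℝ => a * (Real.log β / β ^ (A / 2))) atTop (𝓝 (a * 0)) :=
      ((isLittleO_log_rpow_atTop hA2).tendsto_div_nhds_zero).const_mul a
    rw [mul_zero] at h2
    have h3 := h1.add h2
    rw [add_zero] at h3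
    refine h3.congr (fun β => ?_)
    ring
  have hev : ∀ᶠ β : ℝ in atTop, (Real.log (V / κ) + a * Real.log β) / β ^ (A / 2) ≤ 1 :=
    (hnum.eventually (eventually_le_nhds zero_lt_one)).mono fun β h => h
  obtain ⟨β₂, hβ₂⟩ := eventually_atTop.1 (hev.and (eventually_gt_atTop 0))
  refine ⟨max β₀ β₂, fun β hβ μ hμ m hm hiii => ?_⟩
  obtain ⟨hβ1, hβpos⟩ := hβ₂ β ((le_max_right _ _).trans hβ)
  have hmle := hrate β ((le_max_left _ _).trans hβ) μ hμ m hm hiii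
  refine hmle.trans ?_
  have hβA : 0 < β ^ A := Real.rpow_pos_of_pos hβpos A
  have hβA2 : 0 < β ^ (A / 2) := Real.rpow_pos_of_pos hβpos _
  have hceil : β ^ A ≤ (⌈β ^ A⌉₊ : ℝ) := Nat.le_ceil _
  have hlog : Real.log (V / (κ * β ^ (-a))) = Real.log (V / κ) + a * Real.log β := by
    rw [Real.rpow_neg hβpos.le, ← div_div, div_inv_eq_mul,
      Real.log_mul (div_pos hV hκ).ne' (Real.rpow_pos_of_pos hβpos a).ne', Real.log_rpow hβpos]
  show Real.log (V / (κ * β ^ (-(2 + 8 * A)))) / (⌈β ^ A⌉₊ : ℝ) ≤ β ^ (-(A / 2))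
  rw [← hadef, hlog]
  have hnumle : Real.log (V / κ) + a * Real.log β ≤ β ^ (A / 2) := (div_le_one hβA2).1 hβ1
  have htarget : β ^ (A / 2) / β ^ A = β ^ (-(A / 2)) := by
    rw [← Real.rpow_sub hβpos]
    congr 1
    ring
  rcases le_or_gt 0 (Real.log (V / κ) + a * Real.log β) with hpos | hneg
  · calc (Real.log (V / κ) + a * Real.log β) / (⌈β ^ A⌉₊ : ℝ)
        ≤ (Real.log (V / κ) + a * Real.log β) / β ^ A :=
          div_le_div_of_nonneg_left hpos hβA hceil
      _ ≤ β ^ (A / 2) / β ^ A := div_le_div_of_nonneg_right hnumle hβA.le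
      _ = β ^ (-(A / 2)) := htarget
  · have h0 : (Real.log (V / κ) + a * Real.log β) / (⌈β ^ A⌉₊ : ℝ) ≤ 0 :=
      div_nonpos_of_nonpos_of_nonneg hneg.le (Nat.cast_nonneg _)
    exact h0.trans (Real.rpow_nonneg hβpos.le _)

end General

/-! ### The `SU(2)` instance: the torus floor is proved in the tree, so the crux's conclusion holds for `SU(2)` now -/

/-- **`SU(2)`: the pair-clustering rate of every torus-limit state is `≤ β^{-ε}`** (fundamental Wilson action, `d = 4`): the
tree's BOX_W `ColdBoxTwoPointFloorW_proof`, BULK_W `BulkDominatesColdBoxW_proof` and FLOOR `curvatureCorrPowerFloor_proof` give the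
torus plaquette floor (`polySeparationPlaquetteFloor_of_box`), and `clusterRate_of_polySeparationFloor` converts it.  The sup-norm
clustering analogue of `xiPowSU2_holds`; an UPPER bound on the clustering rate, not a gap. -/
theorem clusterRate_SU2 :
    ∃ ε β₁ : ℝ, 0 < ε ∧ ∀ β : ℝ, β₁ ≤ β →
      ∀ μ ∈ infiniteVolumeLimitPoints (d := 4) (G := Matrix.specialUnitaryGroup (Fin 2) ℂ) (fundamentalRep (Fin 2)) β,
      ∀ m : ℝ, 0 < m →
      (∀ (A B : LGConfig 4 (Matrix.specialUnitaryGroup (Fin 2) ℂ) → ℝ), IsPosTimeObs A → IsPosTimeObs B → ∀ a b : ℝ,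
        (∀ U, |A U| ≤ a) → (∀ U, |B U| ≤ b) → ∀ t : ℕ,
        |(∫ U, A (timeReflectLG U) * B (timeShiftLG (G := Matrix.specialUnitaryGroup (Fin 2) ℂ) t U) ∂μ) -
          (∫ U, A (timeReflectLG U) ∂μ) * (∫ U, B (timeShiftLG (G := Matrix.specialUnitaryGroup (Fin 2) ℂ) t U) ∂μ)| ≤
            2 * Real.exp (-(m * t)) * a * b) →
      m ≤ β ^ (-ε) := by
  obtain ⟨θ₀, hθ₀, hbox⟩ := ColdBoxTwoPointFloorW_proof
  obtain ⟨A, θ, hA, hAθ, hθ, hbulk⟩ := BulkDominatesColdBoxW_proof θ₀ hθ₀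
  obtain ⟨c, hc, hboxd⟩ := hbox A θ hA hAθ hθ
  obtain ⟨κ, hκ, hfloor⟩ :=
    polySeparationPlaquetteFloor_of_box (fundamentalRep (Fin 2)) hA hc hboxd hbulk curvatureCorrPowerFloor_proof
  obtain ⟨β₁, hβ₁⟩ := clusterRate_of_polySeparationFloor (fundamentalRep (Fin 2)) (continuous_fundamentalRep (Fin 2))
    (i := 1) (j := 2) (by decide) (by decide) hA hκ hfloor
  exact ⟨A / 2, β₁, by linarith, hβ₁⟩

/-- **The `SU(2)` instance of the crux `SteinBlockTransferG`, unconditionally** (fundamental representation `fundamentalLatticeRep 2`,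
the rev-0 typing of the crux): for every `C₀` there are `K, δ > 0, C > 0, β₀` such that every torus-limit state at `β ≥ β₀`
satisfying (i) equipartition, (ii) axis symmetry and (iii) pair clustering at rate `m > 0` has its probe time-covariance within
`C (1 + m⁻¹ + n)^K β^{-δ}` of the free profile `2^{-D}((1 - c_n²)^{-D/2} - 1)` at every separation `n ≥ 1` — by
`transfer_of_clusterRate` and `clusterRate_SU2`, i.e. WITHOUT any generator comparison: the free exponents let the clustering rate
absorb the bound.  Evidence for the planner that the crux as filed isolates no Stein content; nothing about a mass gap. -/
theorem transfer_SU2 (C₀ : ℝ) :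
    ∃ (K δ C β₀ : ℝ), 0 < δ ∧ 0 < C ∧ ∀ β : ℝ, β₀ ≤ β →
      ∀ μ ∈ infiniteVolumeLimitPoints (d := 4) (G := Matrix.specialUnitaryGroup (Fin 2) ℂ) (fundamentalRep (Fin 2)) β,
      (∀ (x : Site 4) (i j : Fin 4), i ≠ j → ∫ U, (((2 : ℕ) : ℝ) - plaquetteObs (fundamentalRep (Fin 2)) x i j U) ∂μ ≤ C₀ / β) →
      (∀ (σ : Equiv.Perm (Fin 4)) (F : LGConfig 4 (Matrix.specialUnitaryGroup (Fin 2) ℂ) → ℝ)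
        (S : Finset (Literature.MathematicalPhysics.QuantumLattice.ZdEdge 4)), IsCylinder F S → Continuous F →
        (∃ C, ∀ U, |F U| ≤ C) → ∫ U, F (relabelConfig (edgePerm σ) U) ∂μ = ∫ U, F U ∂μ) →
      ∀ m : ℝ, 0 < m →
      (∀ (A B : LGConfig 4 (Matrix.specialUnitaryGroup (Fin 2) ℂ) → ℝ), IsPosTimeObs A → IsPosTimeObs B → ∀ a b : ℝ,
        (∀ U, |A U| ≤ a) → (∀ U, |B U| ≤ b) → ∀ t : ℕ,
        |(∫ U, A (timeReflectLG U) * B (timeShiftLG (G := Matrix.specialUnitaryGroup (Fin 2) ℂ) t U) ∂μ) -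
          (∫ U, A (timeReflectLG U) ∂μ) * (∫ U, B (timeShiftLG (G := Matrix.specialUnitaryGroup (Fin 2) ℂ) t U) ∂μ)| ≤
            2 * Real.exp (-(m * t)) * a * b) →
      ∀ n : ℕ, 1 ≤ n →
      let P : LGConfig 4 (Matrix.specialUnitaryGroup (Fin 2) ℂ) → ℝ := fun U =>
        Real.exp (-2 * max (β * (((2 : ℕ) : ℝ) - plaquetteObs (fundamentalRep (Fin 2)) 0 1 2 U)) 0)
      let D : ℝ := (Module.finrank ℝ ↥(Submodule.span ℝ
        {X : Matrix (Fin 2) (Fin 2) ℂ | ∀ t : ℝ, NormedSpace.exp ((t : ℂ) • X) ∈ Set.range (fundamentalRep (Fin 2))}) : ℝ)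
      let c₂ : ℝ := curvaturePlaquetteCorr (d := 4) (by norm_num) (n : ℤ)
      |((∫ U, P U * P (timeShiftLG (G := Matrix.specialUnitaryGroup (Fin 2) ℂ) n U) ∂μ) -
          (∫ U, P U ∂μ) * (∫ U, P (timeShiftLG (G := Matrix.specialUnitaryGroup (Fin 2) ℂ) n U) ∂μ)) -
          (2 : ℝ) ^ (-D) * ((1 - c₂ ^ 2) ^ (-(D / 2)) - 1)| ≤ C * (1 + m⁻¹ + n) ^ K * β ^ (-δ) := by
  obtain ⟨ε, β₁, hε, hrate⟩ := clusterRate_SU2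
  exact transfer_of_clusterRate (fundamentalLatticeRep 2) hε hrate C₀

end Summit.QuantumFields.YangMills.Theorems.SteinGapBootstrap

end
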